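import Literature.AnabelianGeometry.SemiGraphs.PiPresentationBridge
import Literature.AnabelianGeometry.SemiGraphs.CommensurabilityProofs4
import Literature.AnabelianGeometry.SemiGraphs.AmbientVocabOfRealOut
import Literature.AnabelianGeometry.Anabelioids.OuterActionOfEquivalence
import Literature.AnabelianGeometry.Anabelioids.ExactFunctorProofs
import Literature.AnabelianGeometry.Anabelioids.FiberFunctorUnique
import HarnessLib

/-!
# [SemiAnbd] §2/§3: the profinite presentation `𝒢.toProfinite` of a semi-graph of anabelioids (bridge B1)

Mochizuki, *Semi-graphs of anabelioids*, Publ. RIMS **42** (2006), Def. 2.1 pp. 22–24 (kurims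
`paper:url-f33ace170ff4`): for a semi-graph of anabelioids `𝒢 = {𝒢_v, 𝒢_e, b_*}`, "`Π_v`, `Π_b`
[are] the fundamental groups of `𝒢_v`, `𝒢_e` respectively [for some choice of basepoint]", and
`b_* : 𝒢_e → 𝒢_v` induces "`Π_b → Π_v` … the image of `Π_b` in `Π_v`, which is well-defined up to
conjugation in `Π_v`" [cite: MochizukiSemiAnbd2006, Def. 2.1 pp.22-24].

The tree carries TWO presentations of a semi-graph of anabelioids: the categorical one of §2
(`SemiGraphOfAnabelioids`, abc-iut-L3-t1: Galois categories `𝒢_v`, `𝒢_e`, exact pull-back functors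
`b^*`) and the profinite-group one of §3 (`ProfiniteSemiGraph`, abc-iut-L3-t2: profinite `Π_v`,
`Π_e`, continuous `b_* : Π_e → Π_v`), so far related only in the direction
`ProfiniteSemiGraph.toAnab` (`{B(Π_v), B(Π_e), B(b_*)}`; `PiPresentationBridge.lean`).  This file
is the OBJECT-LEVEL BRIDGE IN THE OTHER DIRECTION (step B1 of the (R1) merge debt of the §§4–5
container `SemiAnbdVocab`, HOME/staging/L3/L3-t3/MERGE-MAP.md §4 (1); interface owner abc-iut-L3-t3):

* `SemiGraphOfAnabelioids.fibV 𝒢 v` / `fibE 𝒢 e` — the CANONICAL basepoints (Mathlib's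
  `GaloisCategory.getFiberFunctor`), so that `Π_v := Aut (𝒢.fibV v)` is LITERALLY `SgA.piV`
  (`AmbientVocabOfRealOut.lean`) with Mathlib's profinite topology;
* `SemiGraphOfAnabelioids.branchPath 𝒢 b v h : b^* ⋙ F_e ≅ F_v` — a CHOSEN path from the basepoint
  of `𝒢_v` induced along `b` to the canonical one (exists: an exact functor followed by a fibre
  functor is a fibre functor, `fiberFunctor_comp_of_exact`, and fibre functors are isomorphic,
  `nonempty_iso_of_fiberFunctor`);
* `SemiGraphOfAnabelioids.brHomOfPath 𝒢 b v h α : Π_e →ₜ* Π_v` — `π₁(b^*)` (`pi1Map`, continuous by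
  `continuous_pi1Map`) followed by transport along `α` (`Aut.autMulEquivOfIso α`, continuous), and
  `brHomProfinite := brHomOfPath (branchPath)`; changing the path conjugates (`brHomOfPath_eq_conj`,
  "well-defined up to conjugation");
* `SemiGraphOfAnabelioids.toProfinite 𝒢 : ProfiniteSemiGraph` — same underlying semi-graph,
  `Π_v`, `Π_e`, `b_*` as above;
* the dictionary: `branchSubgroup_toProfinite` (the §3 branch subgroup `range b_*` IS t1's §2
  `branchSubgroup F_v b h F_e (branchPath)`), `isOfInjectiveType_toProfinite_iff`,
  `isVerticiallySlim_toProfinite_iff`, `isCountable_toProfinite_iff`, and `toProfinite_Gv_eq_piV`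
  (for objects of the ambient category `SgA` of §§4–5).

Sequel steps (not here): B2 1-morphisms ↦ `ProfiniteSemiGraph.Hom` (via `pi1Map` and the paths, up
to conjugation), B3 `𝒢.toProfinite.toAnab ≅ 𝒢` (Mathlib's `functorToContAction` equivalences), B4
tempered arrows of `SgA` through `CovObj.coveringGraph` of `𝒢.toProfinite` (Def. 3.5 (ii)).
Definitions + dictionary lemmas only; nothing of the paper is asserted; no side taken on
[IUTchIII] Cor. 3.12.
-/

noncomputable section

namespace Literature.AnabelianGeometry.SemiGraphs

open CategoryTheory CategoryTheory.Limits CategoryTheory.PreGaloisCategory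
open Literature.AnabelianGeometry.Anabelioids
open Literature.AlgebraicGeometry.Frobenioids (IsSlimGroup)

universe u

/-! ### Transport of automorphisms along an isomorphism of basepoints is continuous -/

section Transport

variable {D : Type*} [Category D]

/-- Mathlib's two transports of automorphisms along an isomorphism agree: `Aut.autMulEquivOfIso α`
(t1's currency for branch subgroups) is `α.conjAut` ([GeoAn] §1.1 p.10: the identification of
fundamental groups at two basepoints along a path). [cite: MochizukiGeoAn2004, Def. 1.1.2(ii) p.10] -/
theorem Aut.autMulEquivOfIso_apply_eq_conjAut {F G : D} (α : F ≅ G) (x : Aut F) :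
    Aut.autMulEquivOfIso α x = α.conjAut x := by
  ext : 1
  simp [Aut.autMulEquivOfIso, Iso.conjAut_hom, Iso.conj_apply]

/-- Transport of automorphisms of functors to finite sets along an isomorphism `α : F ≅ G` is
continuous for Mathlib's profinite topologies on `Aut F`, `Aut G` ([GeoAn] §1.1 p.10: change of
basepoint "as topological groups"). [cite: MochizukiGeoAn2004, Def. 1.1.2(ii) p.10] -/
theorem Aut.continuous_autMulEquivOfIso {C : Type*} [Category.{u} C] {F G : C ⥤ FintypeCat.{u}}
    (α : F ≅ G) : Continuous (Aut.autMulEquivOfIso α) := by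
  have h : (Aut.autMulEquivOfIso α : Aut F → Aut G) = α.conjAut :=
    funext fun x => Aut.autMulEquivOfIso_apply_eq_conjAut α x
  rw [h]
  exact continuous_conjAut_iso α

/-- Transport along `α` as an isomorphism of TOPOLOGICAL groups `Aut F ≃ₜ* Aut G`.
[cite: MochizukiGeoAn2004, Def. 1.1.2(ii) p.10] -/
def Aut.continuousMulEquivOfIso {C : Type*} [Category.{u} C] {F G : C ⥤ FintypeCat.{u}}
    (α : F ≅ G) : Aut F ≃ₜ* Aut G :=
  { Aut.autMulEquivOfIso α with
    continuous_toFun := Aut.continuous_autMulEquivOfIso α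
    continuous_invFun := by
      have h : ((Aut.autMulEquivOfIso α).symm : Aut G → Aut F) = Aut.autMulEquivOfIso α.symm := by
        funext y
        ext : 1
        simp [Aut.autMulEquivOfIso]
      change Continuous ((Aut.autMulEquivOfIso α).symm : Aut G → Aut F)
      rw [h]
      exact Aut.continuous_autMulEquivOfIso α.symm }

/-- Underlying function of the topological transport. [cite: MochizukiGeoAn2004, Def. 1.1.2(ii) p.10] -/
@[simp] theorem Aut.continuousMulEquivOfIso_apply {C : Type*} [Category.{u} C] {F G : C ⥤ FintypeCat.{u}}
    (α : F ≅ G) (x : Aut F) : Aut.continuousMulEquivOfIso α x = Aut.autMulEquivOfIso α x := rfl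

end Transport

namespace SemiGraphOfAnabelioids

variable (𝒢 : SemiGraphOfAnabelioids.{u, u, u})

/-! ### Canonical basepoints and the chosen paths along branches -/

/-- The CANONICAL basepoint of the vertex anabelioid `𝒢_v` (Mathlib's chosen fibre functor of the
Galois category `𝒢_v`; "for some choice of basepoint", Def. 2.1 p.23).
[cite: MochizukiSemiAnbd2006, Def. 2.1 p.23] -/
abbrev fibV (v : 𝒢.graph.Vertex) : 𝒢.V v ⥤ FintypeCat.{u} := GaloisCategory.getFiberFunctor (𝒢.V v)

/-- The CANONICAL basepoint of the edge anabelioid `𝒢_e`. [cite: MochizukiSemiAnbd2006, Def. 2.1 p.23] -/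
abbrev fibE (e : 𝒢.graph.Edge) : 𝒢.E e ⥤ FintypeCat.{u} := GaloisCategory.getFiberFunctor (𝒢.E e)

/-- The basepoint of `𝒢_v` induced along the branch `b` from the canonical basepoint of `𝒢_e`
(`b^* ⋙ F_e`) is a basepoint: an exact functor followed by a fibre functor is a fibre functor
([SGA1] V 6.1, `fiberFunctor_comp_of_exact`). [cite: MochizukiSemiAnbd2006, Def. 2.1 p.23] -/
theorem fiberFunctor_pull_comp_fibE (b : 𝒢.graph.Branch) (v : 𝒢.graph.Vertex)
    (h : 𝒢.graph.abuts b = some v) :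
    FiberFunctor ((𝒢.pull b v h).pullback ⋙ 𝒢.fibE (𝒢.graph.edgeOf b)) :=
  fiberFunctor_comp_of_exact _ _

/-- There is a path from the basepoint induced along `b` to the canonical basepoint of `𝒢_v` (any two
basepoints of a connected anabelioid are isomorphic, [SGA1] V 5.7). [cite: MochizukiSemiAnbd2006, Def. 2.1 p.23] -/
theorem nonempty_branchPath (b : 𝒢.graph.Branch) (v : 𝒢.graph.Vertex)
    (h : 𝒢.graph.abuts b = some v) :
    Nonempty ((𝒢.pull b v h).pullback ⋙ 𝒢.fibE (𝒢.graph.edgeOf b) ≅ 𝒢.fibV v) := by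
  haveI := 𝒢.fiberFunctor_pull_comp_fibE b v h
  exact nonempty_iso_of_fiberFunctor _ _

/-- A CHOSEN path `α_b : b^* ⋙ F_e ≅ F_v` along the branch `b` abutting to `v` (the choice behind "the
image of `Π_b` in `Π_v`, which is well-defined up to conjugation in `Π_v`", pp. 23–24).
[cite: MochizukiSemiAnbd2006, Def. 2.1 pp.23-24] -/
def branchPath (b : 𝒢.graph.Branch) (v : 𝒢.graph.Vertex) (h : 𝒢.graph.abuts b = some v) :
    (𝒢.pull b v h).pullback ⋙ 𝒢.fibE (𝒢.graph.edgeOf b) ≅ 𝒢.fibV v :=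
  Classical.choice (𝒢.nonempty_branchPath b v h)

/-! ### The continuous homomorphisms `b_* : Π_e → Π_v` -/

/-- `π₁(b^*) : Π_e = Aut F_e → Aut (b^* ⋙ F_e)` as a CONTINUOUS homomorphism (t1's `piBToPiV`,
continuous by `continuous_pi1Map`). [cite: MochizukiSemiAnbd2006, Def. 2.1 p.23] -/
def piBToPiVCont (b : 𝒢.graph.Branch) (v : 𝒢.graph.Vertex) (h : 𝒢.graph.abuts b = some v) :
    Aut (𝒢.fibE (𝒢.graph.edgeOf b)) →ₜ*
      Aut ((𝒢.pull b v h).pullback ⋙ 𝒢.fibE (𝒢.graph.edgeOf b)) where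
  toMonoidHom := 𝒢.piBToPiV b v h (𝒢.fibE (𝒢.graph.edgeOf b))
  continuous_toFun := continuous_pi1Map _ _

/-- `b_* : Π_e → Π_v` for a given path `α : b^* ⋙ F_e ≅ F_v`: `π₁(b^*)` followed by transport along
`α`. [cite: MochizukiSemiAnbd2006, Def. 2.1 pp.23-24] -/
def brHomOfPath (b : 𝒢.graph.Branch) (v : 𝒢.graph.Vertex) (h : 𝒢.graph.abuts b = some v)
    (α : (𝒢.pull b v h).pullback ⋙ 𝒢.fibE (𝒢.graph.edgeOf b) ≅ 𝒢.fibV v) :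
    Aut (𝒢.fibE (𝒢.graph.edgeOf b)) →ₜ* Aut (𝒢.fibV v) :=
  (Aut.continuousMulEquivOfIso α : _ →ₜ* _).comp (𝒢.piBToPiVCont b v h)

/-- Pointwise formula for `brHomOfPath`. [cite: MochizukiSemiAnbd2006, Def. 2.1 pp.23-24] -/
@[simp] theorem brHomOfPath_apply (b : 𝒢.graph.Branch) (v : 𝒢.graph.Vertex)
    (h : 𝒢.graph.abuts b = some v)
    (α : (𝒢.pull b v h).pullback ⋙ 𝒢.fibE (𝒢.graph.edgeOf b) ≅ 𝒢.fibV v)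
    (x : Aut (𝒢.fibE (𝒢.graph.edgeOf b))) :
    𝒢.brHomOfPath b v h α x =
      Aut.autMulEquivOfIso α (pi1Map (𝒢.pull b v h).pullback (𝒢.fibE (𝒢.graph.edgeOf b)) x) :=
  rfl

/-- The underlying homomorphism of `brHomOfPath α` is t1's composite
`(Aut.autMulEquivOfIso α) ∘ piBToPiV` whose range DEFINES `branchSubgroup … α`
(`GraphOfAnabelioids.lean`). [cite: MochizukiSemiAnbd2006, Def. 2.1 pp.23-24] -/
theorem brHomOfPath_toMonoidHom (b : 𝒢.graph.Branch) (v : 𝒢.graph.Vertex)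
    (h : 𝒢.graph.abuts b = some v)
    (α : (𝒢.pull b v h).pullback ⋙ 𝒢.fibE (𝒢.graph.edgeOf b) ≅ 𝒢.fibV v) :
    (𝒢.brHomOfPath b v h α).toMonoidHom =
      (Aut.autMulEquivOfIso α).toMonoidHom.comp (𝒢.piBToPiV b v h (𝒢.fibE (𝒢.graph.edgeOf b))) :=
  rfl

/-- The range of `brHomOfPath α` is t1's branch subgroup `Π_b^α ⊆ Π_v`.
[cite: MochizukiSemiAnbd2006, Def. 2.1 pp.23-24] -/
theorem range_brHomOfPath (b : 𝒢.graph.Branch) (v : 𝒢.graph.Vertex)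
    (h : 𝒢.graph.abuts b = some v)
    (α : (𝒢.pull b v h).pullback ⋙ 𝒢.fibE (𝒢.graph.edgeOf b) ≅ 𝒢.fibV v) :
    (𝒢.brHomOfPath b v h α).toMonoidHom.range =
      𝒢.branchSubgroup (𝒢.fibV v) b h (𝒢.fibE (𝒢.graph.edgeOf b)) α :=
  rfl

/-- **"Well-defined up to conjugation in `Π_v`"**: changing the path `α` to `α'` conjugates `b_*` by
the element `α⁻¹ ≫ α'` of `Π_v` (`transportAut α α'`). [cite: MochizukiSemiAnbd2006, Def. 2.1 pp.23-24] -/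
theorem brHomOfPath_eq_conj (b : 𝒢.graph.Branch) (v : 𝒢.graph.Vertex)
    (h : 𝒢.graph.abuts b = some v)
    (α α' : (𝒢.pull b v h).pullback ⋙ 𝒢.fibE (𝒢.graph.edgeOf b) ≅ 𝒢.fibV v)
    (x : Aut (𝒢.fibE (𝒢.graph.edgeOf b))) :
    𝒢.brHomOfPath b v h α' x =
      transportAut α α' * 𝒢.brHomOfPath b v h α x * (transportAut α α')⁻¹ := by
  rw [brHomOfPath_apply, brHomOfPath_apply]
  ext : 1
  simp [Aut.autMulEquivOfIso, transportAut, Aut.Aut_mul_def, Aut.Aut_inv_def]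

/-- … in the `∃ g` form of `ProfiniteSemiGraph.Hom.comm`. [cite: MochizukiSemiAnbd2006, Def. 2.1 pp.23-24] -/
theorem exists_brHomOfPath_eq_conj (b : 𝒢.graph.Branch) (v : 𝒢.graph.Vertex)
    (h : 𝒢.graph.abuts b = some v)
    (α α' : (𝒢.pull b v h).pullback ⋙ 𝒢.fibE (𝒢.graph.edgeOf b) ≅ 𝒢.fibV v) :
    ∃ g : Aut (𝒢.fibV v), ∀ x, 𝒢.brHomOfPath b v h α' x = g * 𝒢.brHomOfPath b v h α x * g⁻¹ :=
  ⟨transportAut α α', fun x => 𝒢.brHomOfPath_eq_conj b v h α α' x⟩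

/-- `b_* : Π_e → Π_v` along the CHOSEN path `branchPath b v h`. [cite: MochizukiSemiAnbd2006, Def. 2.1 pp.23-24] -/
def brHomProfinite (b : 𝒢.graph.Branch) (v : 𝒢.graph.Vertex) (h : 𝒢.graph.abuts b = some v) :
    Aut (𝒢.fibE (𝒢.graph.edgeOf b)) →ₜ* Aut (𝒢.fibV v) :=
  𝒢.brHomOfPath b v h (𝒢.branchPath b v h)

/-! ### The profinite presentation -/

/-- **The profinite presentation `{Π_v, Π_e, b_*}` of a semi-graph of anabelioids** (Def. 2.1 p. 23:
"`Π_v`, `Π_b` the fundamental groups of `𝒢_v`, `𝒢_e` [for some choice of basepoint] … `Π_b → Π_v`"),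
as an object of abc-iut-L3-t2's `ProfiniteSemiGraph`: the same underlying semi-graph, the
automorphism groups of the canonical basepoints with Mathlib's profinite topologies, and the branch
homomorphisms along the chosen paths.  REDUCIBLE (as t2's `CovObj.coveringGraph`), so that instance
resolution sees `𝒢.toProfinite.Gv v` as `Aut (𝒢.fibV v)` (Mathlib's `Aut F`-actions on fibres, the
fibre-functor equivalence `functorToContAction`). [cite: MochizukiSemiAnbd2006, Def. 2.1 p.23] -/
@[reducible] def toProfinite : ProfiniteSemiGraph.{u} where
  graph := 𝒢.graph
  Gv v := Aut (𝒢.fibV v)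
  Ge e := Aut (𝒢.fibE e)
  brHom b v h := 𝒢.brHomProfinite b v h

/-- The underlying semi-graph is unchanged. [cite: MochizukiSemiAnbd2006, Def. 2.1 p.23] -/
@[simp] theorem toProfinite_graph : 𝒢.toProfinite.graph = 𝒢.graph := rfl

/-- `Π_v` of the profinite presentation is `Aut` of the canonical basepoint of `𝒢_v`.
[cite: MochizukiSemiAnbd2006, Def. 2.1 p.23] -/
theorem toProfinite_Gv (v : 𝒢.graph.Vertex) : 𝒢.toProfinite.Gv v = Aut (𝒢.fibV v) := rfl

/-- `Π_e` of the profinite presentation is `Aut` of the canonical basepoint of `𝒢_e`.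
[cite: MochizukiSemiAnbd2006, Def. 2.1 p.23] -/
theorem toProfinite_Ge (e : 𝒢.graph.Edge) : 𝒢.toProfinite.Ge e = Aut (𝒢.fibE e) := rfl

/-- The branch homomorphisms of the profinite presentation. [cite: MochizukiSemiAnbd2006, Def. 2.1 p.23] -/
theorem toProfinite_brHom (b : 𝒢.graph.Branch) (v : 𝒢.graph.Vertex)
    (h : 𝒢.graph.abuts b = some v) :
    𝒢.toProfinite.brHom b v h = 𝒢.brHomOfPath b v h (𝒢.branchPath b v h) := rfl

/-- Pointwise: `b_* x = α_b ⋆ π₁(b^*)(x)`. [cite: MochizukiSemiAnbd2006, Def. 2.1 p.23] -/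
theorem toProfinite_brHom_apply (b : 𝒢.graph.Branch) (v : 𝒢.graph.Vertex)
    (h : 𝒢.graph.abuts b = some v) (x : Aut (𝒢.fibE (𝒢.graph.edgeOf b))) :
    𝒢.toProfinite.brHom b v h x =
      Aut.autMulEquivOfIso (𝒢.branchPath b v h)
        (pi1Map (𝒢.pull b v h).pullback (𝒢.fibE (𝒢.graph.edgeOf b)) x) :=
  rfl

/-! ### Dictionary -/

/-- **The §3 branch subgroup `range b_* ⊆ Π_v` of the profinite presentation IS the §2 branch
subgroup** `Π_b^{α_b}` of `GraphOfAnabelioids.lean` at the canonical basepoints and the chosen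
path. [cite: MochizukiSemiAnbd2006, Def. 2.1 pp.23-24] -/
theorem branchSubgroup_toProfinite (b : 𝒢.graph.Branch) (v : 𝒢.graph.Vertex)
    (h : 𝒢.graph.abuts b = some v) :
    𝒢.toProfinite.branchSubgroup b v h =
      𝒢.branchSubgroup (𝒢.fibV v) b h (𝒢.fibE (𝒢.graph.edgeOf b)) (𝒢.branchPath b v h) :=
  rfl

/-- Countability is a property of the underlying semi-graph, unchanged.
[cite: MochizukiSemiAnbd2006, §1 p.11] -/
theorem isCountable_toProfinite_iff : 𝒢.toProfinite.IsCountable ↔ 𝒢.graph.IsCountable := Iff.rfl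

/-- **"Of injective type" agrees** (Def. 2.1 p. 22: every `b_*` a `π₁`-monomorphism ↔ every
`b_* : Π_e → Π_v` injective — `isPi1Mono_iff_injective` at the canonical basepoint, transport being
bijective). [cite: MochizukiSemiAnbd2006, Def. 2.1 p.22] -/
theorem isOfInjectiveType_toProfinite_iff :
    𝒢.toProfinite.IsOfInjectiveType ↔ 𝒢.IsOfInjectiveType := by
  rw [isOfInjectiveType_iff]
  refine forall₃_congr fun b v h => ?_
  rw [isPi1Mono_iff_injective (𝒢.pull b v h).pullback (𝒢.fibE (𝒢.graph.edgeOf b))]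
  change Function.Injective (𝒢.brHomOfPath b v h (𝒢.branchPath b v h)) ↔ _
  exact (Aut.autMulEquivOfIso (𝒢.branchPath b v h)).injective.of_comp_iff _

/-- **"Verticially slim" agrees** (Def. 2.4 (ii) p. 25: every `𝒢_v` slim ↔ every `Π_v` a slim
profinite group — `isSlim_iff_isSlimGroup_aut` at the canonical basepoint).
[cite: MochizukiSemiAnbd2006, Def. 2.4(ii) p.25] -/
theorem isVerticiallySlim_toProfinite_iff :
    𝒢.toProfinite.IsVerticiallySlim ↔ 𝒢.IsVerticiallySlim := by
  rw [isVerticiallySlim_iff]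
  refine forall_congr' fun v => ?_
  exact (isSlim_iff_isSlimGroup_aut (𝒢.fibV v)).symm

end SemiGraphOfAnabelioids

/-! ### At the ambient category of §§4–5 -/

namespace SgAQuot.SgA

/-- For an object `G` of the ambient category `SgA` of [SemiAnbd] §§4–5, the vertex group of the
profinite presentation is `SgA.piV G v` on the nose (same canonical basepoint).
[cite: MochizukiSemiAnbd2006, Def. 2.1 p.23] -/
theorem toProfinite_Gv_eq_piV (G : SgA.{u, u, u}) (v : G.toSgA.graph.Vertex) :
    G.toSgA.toProfinite.Gv v = G.piV v := rfl

/-- Every object of `SgA` has a verticially slim profinite presentation (objects of the ambient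
category are verticially slim). [cite: MochizukiSemiAnbd2006, Rmk 2.4.2, p. 26] -/
theorem isVerticiallySlim_toProfinite (G : SgA.{u, u, u}) : G.toSgA.toProfinite.IsVerticiallySlim :=
  G.toSgA.isVerticiallySlim_toProfinite_iff.mpr G.property.2.1

end SgAQuot.SgA

end Literature.AnabelianGeometry.SemiGraphs

end
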